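import Summits.BirchSwinnertonDyer.BirchSwinnertonDyer.Theorems.AlignedTransportAtTwoMainConjectureOfRankZeroBSDAtTwoSexticNormRelationDescentMu
import Summits.BirchSwinnertonDyer.BirchSwinnertonDyer.Theorems.AlignedTransportAtTwoMainConjectureOfRankZeroBSDAtTwoResolventLambdaParity
import Literature.NumberTheory.IwasawaTheory.SymmetricThreeTowerLambda
import Literature.NumberTheory.IwasawaTheory.FerreroKidaLambdaTwoImaginaryQuadraticProof
import Literature.NumberTheory.IwasawaTheory.ClassNumberPExpCoprimeGaloisCongruence
import Literature.NumberTheory.IwasawaTheory.ClassicalMuVanishesKleinDescent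
import Literature.NumberTheory.IwasawaTheory.ClassicalMuVanishesImaginaryQuadraticTwoProofs
import HarnessLib

/-!
# Route `AlignedTransportAtTwo`, crux C2 `MainConjectureOfRankZeroBSDAtTwo` (stmt-BirchSwinnertonDyer-22298):
# THE `S₃` KURODA RELATION AT `p = 2` ON THE SEXTIC CARRIER — `λ₂(ℚ(W[2])) = λ₂(ℚ(√Δ_W)) + 2·λ₂(ℚ(β))`, hence
# `λ₂(ℚ(W[2])) + 1 = 2·λ₂(ℚ(β)) + Σ_{ℓ ∣ d odd} 2^{ord₂(ℓ²−1)−3}` (Ferrero–Kida), granted `μ₂ = 0` on the cubic towers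

HONEST FRAMING (cell `bsd-f1-sign2`, WIDTH-5 attached prover seat `bsd-line-att-p3` gen 33 on line `birth` of the lead
`bsd-line-att-p2`; `--supports` stmt-BirchSwinnertonDyer-22298, closes nothing; BSD is NOT proved by any of this; the crux C2, its verdict
«blocked-on `Rank1Residual.GreenbergMuConjectureIrreducible`» and every registered stub are untouched).  THEOREMS ONLY — no definition,
no named fact, no `sorry`; the only arithmetic input is the DISPLAYED hypothesis «`μ₂ = 0` (growth form) for the cyclotomic `ℤ₂`-towers
of the three (conjugate) cubic fields `ℚ(β_j)`» = the currency H3M⁻ of the cubic road (`…CubicCriterion`, `…CubicCarrierRoad`).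

WHY.  The planner's C2 input ledger prices the crux on `Δ_W < 0` either on the SEXTIC carrier `T = ℚ(W[2])` (`…SexticCriterion`,
`…MuNecessity`, PFμ⁺) or on the CUBIC carrier `ℚ(β)` (`…CubicCriterion`); this lineage priced `λ₂(T)` by the resolvent `K = ℚ(√Δ_W)`
(g26 `λ₂(T) ≥ 3` on the Kilford stratum, g29 parity `λ₂(T) ≡ λ₂(K) (mod 2)`, g31/g32 Ferrero–Kida `λ₂(K) = Σ − 1` EXACTLY, census floors
`λ₂(T) ≥ 17 / 33`), and att-p4 g28 gave the one-sided `S₃`-descent `e_n(T) ≤ 3e_n(ℚ(β)) + e_n(K)`.  This file makes the conversion EXACT: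

* §1 `exists_symmetricThree_generators` (finite group of order `6` with a subgroup `C` of order `3` and two distinct subgroups `H ≠ H'` of
  order `2`: `σ := τ τ'` with `⟨τ⟩ = H`, `⟨τ'⟩ = H'` gives `⟨σ⟩ = C`, `σ³ = τ² = 1`, `τσ = σ²τ`, `⟨σ, τ⟩ = G` — no case analysis: `σ ∈ C` by the
  index-`2` product rule) and §2 its instance `exists_symmetricThree_gal` for `Gal(T/ℚ)` from att-p4 g28's subgroup data (`|G| = 6`,
  `|C| = 3`, `|H_j| = 2`, `H_i ≠ H_j`).
* §3 ★ `classicalLambda_divisionField_two_eq_resolvent_add_two_mul_cubic`: **for `W/ℚ` with `W(ℚ)[2] = 0` and `Δ_W < 0`, every `j`, and any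
  cyclotomic `ℤ₂`-extensions `κT`, `κK`, `κk` of `T`, `ℚ(4δ₀)` (`(4δ₀)² = Δ_W`) and `ℚ(β_j)`: `μ₂ = 0` on the three cubic towers ⟹
  `λ₂(T) = λ₂(ℚ(√Δ_W)) + 2·λ₂(ℚ(β_j))`** (`IwasawaTheory.classicalLambda_symmetricThree` — the `λ`-part of the Brauer–Kuroda relation of
  `S₃` at `2`, proved from the algebraic `S₃` class-number relation + ambiguous-class sandwich; `μ₂(K) = 0` is the tree theorem
  `classicalMuVanishes_imaginaryQuadratic_cyclotomic_two`, `μ₂(T) = 0` is att-p4 g28's descent).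
* §4 ★ `classicalLambda_divisionField_two_add_one_eq`: with `Δ_W = −d·q²`, `d > 2` squarefree: **`λ₂(T) + 1 = 2·λ₂(ℚ(β_j)) +
  Σ_{p ∣ d, p ≠ 2} 2^{ord₂(p²−1)−3}`** (Ferrero–Kida, g32's `ferreroKida_classicalLambda_two_imaginaryQuadratic_holds`).  So on the whole
  `Δ_W < 0` cell the sextic `λ`-certificate problem IS the cubic one: `λ₂(T)` is odd iff `Σ` is even (g29's parity law, now with the
  even excess identified as `2λ₂(ℚ(β))`), `λ₂(T) ≥ Σ − 1` with equality iff `λ₂(ℚ(β)) = 0`, and the census floors become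
  `λ₂(T) = 17 + 2λ₂(ℚ(β))` (7831a1), `33 + 2λ₂(ℚ(β))` (24213c1).

LEDGER READING (-imc): modulo NOTHING beyond `μ₂(ℚ(β)^{cyc}) = 0` (the cubic road's own input H3M⁻) the Iwasawa `λ`-invariant of the
sextic carrier is an explicit affine function of the cubic one; no new print fact; nothing closed; BSD is not proved.

References: [Bartel2012] Thm. 1.2 (exact `2`-part Brauer–Kuroda for `D_6`, analytic — not used); [Lemmermeyer1994] §1; [Washington1997]
§13; [Schettler2014] Thm. 2 (Ferrero 1980 / Kida 1979); tree: `Literature/…/KurodaRelationSymmetricThree(Ambiguous)`,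
`IwasawaTheory/SymmetricThreeTowerLambda` (this seat), `…SexticNormRelationDescent(Mu)` (att-p4 g28), `…ResolventLambdaParity` (g29),
`FerreroKidaLambdaTwoImaginaryQuadraticProof` (g32), `ClassicalMuVanishesImaginaryQuadraticTwoProofs` (bsd-2adic).
-/

set_option linter.dupNamespace false
set_option autoImplicit false

noncomputable section

open scoped Classical NumberField

namespace Summit.BirchSwinnertonDyer.BirchSwinnertonDyer.Theorems.AlignedTransportAtTwoSexticLambdaKuroda

open NumberField Polynomial WeierstrassCurve IntermediateField Field
  Literature.NumberTheory.EllipticCurves Literature.NumberTheory.EllipticCurves.Greenberg1999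
  Literature.NumberTheory.EllipticCurves.DokchitserDokchitser2012
  Literature.NumberTheory.EllipticCurves.ZpExtension Literature.NumberTheory.GaloisRepresentations
  Literature.NumberTheory.IwasawaTheory Literature.NumberTheory.NumberFields
  Summit.BirchSwinnertonDyer.BirchSwinnertonDyer.Theorems.AlignedTransportAtTwoFineRoad.DivisionCubic
  Summit.BirchSwinnertonDyer.BirchSwinnertonDyer.Theorems.AlignedTransportAtTwoFineRoad.TowerImageDelta
  Summit.BirchSwinnertonDyer.BirchSwinnertonDyer.Theorems.AlignedTransportAtTwoCubicClosureParity
  Summit.BirchSwinnertonDyer.BirchSwinnertonDyer.Theorems.AlignedTransportAtTwoSexticTowerGrowth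
  Summit.BirchSwinnertonDyer.BirchSwinnertonDyer.Theorems.AlignedTransportAtTwoSexticNormRelationDescent
  Summit.BirchSwinnertonDyer.BirchSwinnertonDyer.Theorems.AlignedTransportAtTwoSexticNormRelationDescentMu

/-! ## §1 `S₃` generators from subgroup data (a group of order `6`) -/

/-- **`S₃`-generators from subgroup data.**  In a group of order `6` with a subgroup `C` of order `3` and two DISTINCT subgroups `H ≠ H'`
of order `2`, the generators `τ` of `H`, `τ'` of `H'` and `σ := τ τ'` satisfy `⟨σ⟩ = C`, `⟨τ⟩ = H`, `σ³ = 1`, `τ² = 1`, `τσ = σ²τ` and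
`⟨σ, τ⟩ = G`.  (`σ ∈ C` by the product rule for the index-`2` subgroup `C`, `σ ≠ 1` as `τ ≠ τ'`; the relation is `σ³ = 1` rewritten.) -/
theorem exists_symmetricThree_generators {G : Type*} [Group G] [Finite G] (hG : Nat.card G = 6) (C H H' : Subgroup G)
    (hC : Nat.card C = 3) (hH : Nat.card H = 2) (hH' : Nat.card H' = 2) (hne : H ≠ H') :
    ∃ σ τ : G, Subgroup.zpowers σ = C ∧ Subgroup.zpowers τ = H ∧ σ ^ 3 = 1 ∧ τ ^ 2 = 1 ∧ τ * σ = σ ^ 2 * τ ∧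
      Subgroup.closure ({σ, τ} : Set G) = ⊤ := by
  -- generators of the order-`2` subgroups
  have gen2 : ∀ H₀ : Subgroup G, Nat.card H₀ = 2 → ∃ t : G, Subgroup.zpowers t = H₀ ∧ t ^ 2 = 1 ∧ orderOf t = 2 := by
    intro H₀ h₀
    obtain ⟨⟨t, htH⟩, ht1⟩ := Subgroup.ne_bot_iff_exists_ne_one.mp (H₀.one_lt_card_iff_ne_bot.mp (by omega))
    have ht1' : t ≠ 1 := fun h => ht1 (Subtype.ext (by simpa using h))
    have hord : orderOf t = 2 := by
      have hdvd : orderOf t ∣ 2 := h₀ ▸ Subgroup.orderOf_dvd_natCard H₀ htH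
      rcases (Nat.dvd_prime Nat.prime_two).mp hdvd with h | h
      · exact absurd (orderOf_eq_one_iff.mp h) ht1'
      · exact h
    refine ⟨t, Subgroup.eq_of_le_of_card_ge (Subgroup.zpowers_le.mpr htH) (by rw [Nat.card_zpowers, hord, h₀]),
      by rw [← hord]; exact pow_orderOf_eq_one t, hord⟩
  obtain ⟨τ, hτH, hτ2, hoτ⟩ := gen2 H hH
  obtain ⟨τ', hτ'H, hτ'2, hoτ'⟩ := gen2 H' hH'
  have hττ' : τ ≠ τ' := fun h => hne (by rw [← hτH, ← hτ'H, h])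
  -- `C` has index `2`; elements of order `2` are outside `C`
  have hCi : C.index = 2 := by
    have h := C.card_mul_index; rw [hC, hG] at h; omega
  have notC : ∀ t : G, orderOf t = 2 → t ∉ C := by
    intro t ht htC
    have h3 : orderOf t ∣ 3 := hC ▸ Subgroup.orderOf_dvd_natCard C htC
    rw [ht] at h3; omega
  have hσC : τ * τ' ∈ C := (Subgroup.mul_mem_iff_of_index_two hCi).mpr (iff_of_false (notC τ hoτ) (notC τ' hoτ'))
  have hσ3 : (τ * τ') ^ 3 = 1 := orderOf_dvd_iff_pow_eq_one.mp (hC ▸ Subgroup.orderOf_dvd_natCard C hσC)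
  have hτinv : τ⁻¹ = τ := inv_eq_of_mul_eq_one_right (by rw [← pow_two]; exact hτ2)
  have hτ'inv : τ'⁻¹ = τ' := inv_eq_of_mul_eq_one_right (by rw [← pow_two]; exact hτ'2)
  have hσ1 : τ * τ' ≠ 1 := by
    intro h
    apply hττ'
    rw [← hτinv, inv_eq_iff_mul_eq_one]; exact h
  have hoσ : orderOf (τ * τ') = 3 := by
    have hdvd : orderOf (τ * τ') ∣ 3 := orderOf_dvd_iff_pow_eq_one.mpr hσ3
    rcases (Nat.dvd_prime Nat.prime_three).mp hdvd with h | h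
    · exact absurd (orderOf_eq_one_iff.mp h) hσ1
    · exact h
  have hzσ : Subgroup.zpowers (τ * τ') = C :=
    Subgroup.eq_of_le_of_card_ge (Subgroup.zpowers_le.mpr hσC) (by rw [Nat.card_zpowers, hoσ, hC])
  refine ⟨τ * τ', τ, hzσ, hτH, hσ3, hτ2, ?_, ?_⟩
  · -- `τ (τ τ') = τ'` and `(ττ')² τ = (ττ')⁻¹ τ = τ' τ τ = τ'`
    have h2 : (τ * τ') ^ 2 = (τ * τ')⁻¹ := by
      rw [eq_inv_iff_mul_eq_one, ← pow_succ, hσ3]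
    have hττ : τ * τ = 1 := by rw [← pow_two]; exact hτ2
    calc τ * (τ * τ') = (τ * τ) * τ' := (mul_assoc _ _ _).symm
      _ = τ' := by rw [hττ, one_mul]
      _ = τ' * (τ * τ) := by rw [hττ, mul_one]
      _ = (τ * τ') ^ 2 * τ := by rw [h2, mul_inv_rev, hτinv, hτ'inv, mul_assoc]
  · -- `⟨σ, τ⟩ ⊇ C` properly, `C` of index `2`
    set S := Subgroup.closure ({τ * τ', τ} : Set G) with hS
    have hCS : C ≤ S := by
      rw [← hzσ, Subgroup.zpowers_le]; exact Subgroup.subset_closure (by simp)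
    have hτS : τ ∈ S := Subgroup.subset_closure (by simp)
    have hidx : S.index ∣ 2 := hCi ▸ Subgroup.index_dvd_of_le hCS
    rcases (Nat.dvd_prime Nat.prime_two).mp hidx with h1 | h2
    · exact Subgroup.index_eq_one.mp h1
    · exfalso
      have hcard : Nat.card S = Nat.card C := by
        have a := S.card_mul_index; have b := C.card_mul_index
        rw [h2, hG] at a; rw [hCi, hG] at b; omega
      have hEq : C = S := Subgroup.eq_of_le_of_card_ge hCS (le_of_eq hcard)
      exact notC τ hoτ (hEq ▸ hτS)

variable (W : WeierstrassCurve ℚ) [W.IsElliptic]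

/-! ## §2 The `S₃`-pair of `Gal(ℚ(W[2])/ℚ)` -/

/-- **An `S₃`-pair for `Gal(T/ℚ)`, `T = ℚ(W[2])`** (`W(ℚ)[2] = 0`, `Δ_W < 0`): `σ` of order `3` generating the fixing subgroup of the resolvent
`ℚ(δ) ⊆ T` (`δ = 4δ₀`, `δ² = Δ_W`), `τ` of order `2` generating the fixing subgroup of the cubic `ℚ(β_j) ⊆ T`, with `τσ = σ²τ` and
`⟨σ, τ⟩ = Gal(T/ℚ)`; from att-p4 g28's `natCard_gal` (`6`), `natCard_fixingSubgroup_adjoin_delta` (`3`), `natCard_fixingSubgroup_adjoin_xT` (`2`),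
`fixingSubgroup_adjoin_xT_ne`. -/
theorem exists_symmetricThree_gal (ht : ∀ x : ℚ, ¬ HasRationalTwoTorsionX W x) (hΔ : W.Δ < 0) (j : Fin 3) :
    haveI : IsGalois ℚ (W.divisionField 2) := W.isGalois_divisionField 2
    ∃ σ τ : W.divisionField 2 ≃ₐ[ℚ] W.divisionField 2,
      Subgroup.zpowers σ = (ℚ⟮(⟨4 * delta W two_ne_zero, (delta_mem_and_sq W).1⟩ : W.divisionField 2)⟯).fixingSubgroup ∧
      Subgroup.zpowers τ = (ℚ⟮(⟨xT W two_ne_zero j, xT_mem W j⟩ : W.divisionField 2)⟯).fixingSubgroup ∧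
      σ ^ 3 = 1 ∧ τ ^ 2 = 1 ∧ τ * σ = σ ^ 2 * τ ∧
      Subgroup.closure ({σ, τ} : Set (W.divisionField 2 ≃ₐ[ℚ] W.divisionField 2)) = ⊤ := by
  haveI : IsGalois ℚ (W.divisionField 2) := W.isGalois_divisionField 2
  have hj : j ≠ j + 1 := by fin_cases j <;> decide
  exact exists_symmetricThree_generators (natCard_gal W ht hΔ) _ _ _ (natCard_fixingSubgroup_adjoin_delta W ht hΔ)
    (natCard_fixingSubgroup_adjoin_xT W ht hΔ j) (natCard_fixingSubgroup_adjoin_xT W ht hΔ (j + 1)) (fixingSubgroup_adjoin_xT_ne W ht hΔ hj)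

/-! ## §3 `λ₂(ℚ(W[2])) = λ₂(ℚ(√Δ_W)) + 2·λ₂(ℚ(β))` -/

/-- Transport of `classicalLambda` along an `F`-isomorphism of the base fields of two restricted towers (equal `e_n` at every layer,
tree `classNumberPExp_restrict_eq_of_algEquiv`). -/
theorem classicalLambda_restrict_eq_of_algEquiv {F : Type} [Field F] [NumberField F] (κ : ZpExtension F 2) {E E' : Type} [Field E]
    [NumberField E] [Algebra F E] [Field E'] [NumberField E'] [Algebra F E'] (φ : E ≃ₐ[F] E')
    (hE : Function.Surjective (κ.toContinuousMonoidHom.comp (absGaloisRestrict F E)))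
    (hE' : Function.Surjective (κ.toContinuousMonoidHom.comp (absGaloisRestrict F E'))) :
    classicalLambda (κ.restrict E hE) = classicalLambda (κ.restrict E' hE') := by
  have he : ∀ n, classNumberPExp (κ.restrict E hE) n = classNumberPExp (κ.restrict E' hE') n :=
    fun n => classNumberPExp_restrict_eq_of_algEquiv κ φ hE hE' n
  by_cases hμ : ClassicalMuVanishes (κ.restrict E hE)
  · obtain ⟨ν, n₀, hν⟩ := classicalLambda_spec _ hμ
    exact eq_classicalLambda_of_growth _ (ν := ν) (n₀ := n₀) fun n hn => by rw [← he n]; exact hν n hn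
  · have hμ' : ¬ ClassicalMuVanishes (κ.restrict E' hE') := fun h' =>
      hμ ((classicalMuVanishes_restrict_iff_of_algEquiv κ φ hE hE').mpr h')
    rw [classicalLambda_eq_zero_of_not_classicalMuVanishes _ hμ, classicalLambda_eq_zero_of_not_classicalMuVanishes _ hμ']

/-- ★ **THE `S₃` KURODA RELATION FOR `λ₂` ON THE SEXTIC CARRIER.**  `W/ℚ` elliptic with no rational `2`-torsion abscissa and `Δ_W < 0`
(`T = ℚ(W[2])` an `S₃`-sextic, totally complex).  Let `κT`, `κK`, `κk` be ANY cyclotomic `ℤ₂`-extensions of `T`, of the resolvent model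
`ℚ(4δ₀) ⊆ ℚ̄` (`(4δ₀)² = Δ_W`) and of the cubic model `ℚ(β_j) ⊆ ℚ̄`.  If `μ₂ = 0` (growth form) for the cyclotomic `ℤ₂`-extensions of the
three cubic fields `ℚ(β_i)` (the cubic road's input H3M⁻ at `W`), then
**`classicalLambda κT = classicalLambda κK + 2 · classicalLambda κk`**, i.e. `λ₂(ℚ(W[2])) = λ₂(ℚ(√Δ_W)) + 2 λ₂(ℚ(β))`.
(`μ₂(ℚ(√Δ_W)) = 0` and `μ₂(T) = 0` are then tree theorems: imaginary quadratic genus theory; att-p4 g28's `S₃`-descent.)  Conditional only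
on the displayed `μ`-input; BSD is not proved by any of this. -/
theorem classicalLambda_divisionField_two_eq_resolvent_add_two_mul_cubic (ht : ∀ x : ℚ, ¬ HasRationalTwoTorsionX W x) (hΔ : W.Δ < 0)
    (hμ3 : ∀ i : Fin 3, ∀ κi : ZpExtension ↥ℚ⟮xT W two_ne_zero i⟯ 2, κi.IsCyclotomic → ClassicalMuVanishes κi)
    (j : Fin 3) (κT : ZpExtension (W.divisionField 2) 2) (hκT : κT.IsCyclotomic)
    (κK : ZpExtension ↥ℚ⟮4 * delta W two_ne_zero⟯ 2) (hκK : κK.IsCyclotomic)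
    (κk : ZpExtension ↥ℚ⟮xT W two_ne_zero j⟯ 2) (hκk : κk.IsCyclotomic) :
    classicalLambda κT = classicalLambda κK + 2 * classicalLambda κk := by
  haveI : NumberField (W.divisionField 2) := NumberField.mk
  haveI : IsGalois ℚ (W.divisionField 2) := W.isGalois_divisionField 2
  haveI : ∀ i : Fin 3, FiniteDimensional ℚ ↥ℚ⟮xT W two_ne_zero i⟯ := fun i ↦
    IntermediateField.adjoin.finiteDimensional ((AlgebraicClosure.isAlgebraic ℚ).isAlgebraic _).isIntegral
  haveI : ∀ i : Fin 3, NumberField ↥ℚ⟮xT W two_ne_zero i⟯ := fun i ↦ NumberField.mk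
  haveI : FiniteDimensional ℚ ↥ℚ⟮4 * delta W two_ne_zero⟯ :=
    IntermediateField.adjoin.finiteDimensional ((AlgebraicClosure.isAlgebraic ℚ).isAlgebraic _).isIntegral
  haveI : NumberField ↥ℚ⟮4 * delta W two_ne_zero⟯ := NumberField.mk
  have hsq : ¬ IsSquare W.Δ := fun ⟨r, hr⟩ ↦ by nlinarith [mul_self_nonneg r]
  obtain ⟨κ, hκ⟩ := exists_cyclotomicZpExtension_holds ℚ 2
  have hL := surjective_gal_restrict W ht hΔ κ hκ
  obtain ⟨σ, τ, hσC, hτH, hσ3, hτ2, hτσ, hgen⟩ := exists_symmetricThree_gal W ht hΔ j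
  haveI : ∀ E : IntermediateField ℚ (W.divisionField 2), NumberField ↥E := fun E ↦ NumberField.mk
  have hK := surjective_comp_absGaloisRestrict_of_tower κ ↥(fixedField (Subgroup.zpowers σ)) (W.divisionField 2) hL
  have hk := surjective_comp_absGaloisRestrict_of_tower κ ↥(fixedField (Subgroup.zpowers τ)) (W.divisionField 2) hL
  have hK' := surjective_resolvent_restrict W hΔ κ hκ
  have hk' : ∀ i : Fin 3, Function.Surjective (κ.toContinuousMonoidHom.comp (absGaloisRestrict ℚ ↥ℚ⟮xT W two_ne_zero i⟯)) :=
    fun i ↦ surjective_cubic_restrict W ht κ i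
  -- models of the two fixed fields
  obtain ⟨φK₀⟩ := nonempty_algEquiv_fixedField_resolvent W
  obtain ⟨φk₀⟩ := nonempty_algEquiv_fixedField_cubic W j
  have φK : ↥(fixedField (Subgroup.zpowers σ)) ≃ₐ[ℚ] ↥ℚ⟮4 * delta W two_ne_zero⟯ :=
    (IntermediateField.equivOfEq (by rw [hσC])).trans φK₀
  have φk : ↥(fixedField (Subgroup.zpowers τ)) ≃ₐ[ℚ] ↥ℚ⟮xT W two_ne_zero j⟯ :=
    (IntermediateField.equivOfEq (by rw [hτH])).trans φk₀
  -- `μ = 0` inputs: cubic (hypothesis), resolvent (imaginary quadratic, tree), sextic (att-p4's descent)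
  have hIQ : IsImaginaryQuadratic ↥ℚ⟮4 * delta W two_ne_zero⟯ := by
    have hδ := (delta_mem_and_sq W).2
    refine ⟨finrank_adjoin_eq_two_of_sq_eq hδ hsq, ?_⟩
    have hd : ((⟨4 * delta W two_ne_zero, mem_adjoin_simple_self ℚ _⟩ : ↥ℚ⟮4 * delta W two_ne_zero⟯) :
        ↥ℚ⟮4 * delta W two_ne_zero⟯) ^ 2 = ((W.Δ : ℚ) : ↥ℚ⟮4 * delta W two_ne_zero⟯) := by
      apply Subtype.ext
      push_cast
      exact hδ
    exact isTotallyComplex_of_sq_eq_ratCast hd hΔ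
  have hμKall : ∀ κk' : ZpExtension ↥ℚ⟮4 * delta W two_ne_zero⟯ 2, κk'.IsCyclotomic → ClassicalMuVanishes κk' :=
    fun κk' hk'' ↦ classicalMuVanishes_imaginaryQuadratic_cyclotomic_two _ hIQ κk' hk''
  have hμK : ClassicalMuVanishes (κ.restrict ↥(fixedField (Subgroup.zpowers σ)) hK) :=
    (classicalMuVanishes_restrict_iff_of_algEquiv κ φK hK hK').mpr (hμKall _ (isCyclotomic_restrict κ hκ _ hK'))
  have hμk : ClassicalMuVanishes (κ.restrict ↥(fixedField (Subgroup.zpowers τ)) hk) :=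
    (classicalMuVanishes_restrict_iff_of_algEquiv κ φk hk (hk' j)).mpr (hμ3 j _ (isCyclotomic_restrict κ hκ _ (hk' j)))
  have hμT : ClassicalMuVanishes (κ.restrict (W.divisionField 2) hL) :=
    classicalMuVanishes_divisionField_two_of_cubic_of_resolvent W ht hΔ hμ3 hμKall (κ.restrict (W.divisionField 2) hL)
      (isCyclotomic_restrict κ hκ (W.divisionField 2) hL)
  -- odd class numbers of the layers `ℚ_n`
  have hF : ∀ (hT : Function.Surjective (κ.toContinuousMonoidHom.comp
      (absGaloisRestrict ℚ ↥(fixedField (⊤ : Subgroup (W.divisionField 2 ≃ₐ[ℚ] W.divisionField 2)))))) (n : ℕ),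
      classNumberPExp (κ.restrict ↥(fixedField (⊤ : Subgroup (W.divisionField 2 ≃ₐ[ℚ] W.divisionField 2))) hT) n = 0 := by
    intro hT n
    obtain ⟨φ⟩ := nonempty_algEquiv_fixedField_top W
    have h' : Function.Surjective (κ.toContinuousMonoidHom.comp (absGaloisRestrict ℚ ℚ)) :=
      surjective_comp_absGaloisRestrict_of_not_dvd_finrank κ ℚ (by rw [Module.finrank_self]; decide)
    rw [classNumberPExp_restrict_eq_of_algEquiv κ φ hT h' n]
    exact classNumberPExp_rat_eq_zero _ n
  have h4 : ¬ 4 ∣ Module.finrank ℚ (W.divisionField 2) := by rw [finrank_divisionField_two_eq_six W ht hsq]; decide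
  -- the `S₃` relation for `λ` along `κ`, then transport to the given towers
  have main := classicalLambda_symmetricThree κ (W.divisionField 2) hL hσ3 hτ2 hτσ hgen h4 hK hk hF hμT hμK hμk
  rw [classicalLambda_eq_of_isCyclotomic κT (κ.restrict (W.divisionField 2) hL) hκT
      (isCyclotomic_restrict κ hκ (W.divisionField 2) hL),
    classicalLambda_eq_of_isCyclotomic κK (κ.restrict _ hK') hκK (isCyclotomic_restrict κ hκ _ hK'),
    classicalLambda_eq_of_isCyclotomic κk (κ.restrict _ (hk' j)) hκk (isCyclotomic_restrict κ hκ _ (hk' j)),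
    ← classicalLambda_restrict_eq_of_algEquiv κ φK hK hK', ← classicalLambda_restrict_eq_of_algEquiv κ φk hk (hk' j)]
  exact main

/-! ## §4 With Ferrero–Kida: `λ₂(ℚ(W[2])) + 1 = 2·λ₂(ℚ(β)) + Σ_{p ∣ d, p ≠ 2} 2^{ord₂(p²−1)−3}` -/

/-- ★ **`λ₂(ℚ(W[2])) + 1 = 2·λ₂(ℚ(β_j)) + Σ_{p ∣ d, p ≠ 2} 2^{ord₂(p²−1)−3}`** for `W/ℚ` with `W(ℚ)[2] = 0` and `Δ_W = −d·q²`, `d > 2` squarefree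
(so `ℚ(√Δ_W) = ℚ(√−d)`): the sextic `λ₂` is the Ferrero–Kida value of the resolvent plus TWICE the cubic `λ₂`, granted `μ₂ = 0` on the
cubic towers.  (§3 + g32's `ferreroKida_classicalLambda_two_imaginaryQuadratic_holds`.)  Consequences on the C2 ledger: `λ₂(T)` odd iff
`d ≡ ±1 (mod 8)` (g29) with the even excess `= 2λ₂(ℚ(β))`; `λ₂(T) ≥ Σ − 1` with equality iff `λ₂(ℚ(β)) = 0`.  Conditional only on the
displayed `μ`-input; BSD is not proved by any of this. -/
theorem classicalLambda_divisionField_two_add_one_eq (ht : ∀ x : ℚ, ¬ HasRationalTwoTorsionX W x) {d : ℕ} (hsf : Squarefree d)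
    (h2 : 2 < d) {q : ℚ} (hq : q ≠ 0) (hΔd : W.Δ = -(d : ℚ) * q ^ 2)
    (hμ3 : ∀ i : Fin 3, ∀ κi : ZpExtension ↥ℚ⟮xT W two_ne_zero i⟯ 2, κi.IsCyclotomic → ClassicalMuVanishes κi)
    (j : Fin 3) (κT : ZpExtension (W.divisionField 2) 2) (hκT : κT.IsCyclotomic)
    (κk : ZpExtension ↥ℚ⟮xT W two_ne_zero j⟯ 2) (hκk : κk.IsCyclotomic) :
    classicalLambda κT + 1 = 2 * classicalLambda κk + ∑ p ∈ d.primeFactors.erase 2, 2 ^ (padicValNat 2 (p ^ 2 - 1) - 3) := by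
  haveI : FiniteDimensional ℚ ↥ℚ⟮4 * delta W two_ne_zero⟯ :=
    IntermediateField.adjoin.finiteDimensional ((AlgebraicClosure.isAlgebraic ℚ).isAlgebraic _).isIntegral
  haveI : NumberField ↥ℚ⟮4 * delta W two_ne_zero⟯ := NumberField.mk
  have hΔ : W.Δ < 0 := by
    rw [hΔd]
    have : (0 : ℚ) < d := by exact_mod_cast (by omega : 0 < d)
    nlinarith [sq_nonneg q, sq_pos_of_ne_zero hq]
  obtain ⟨κ, hκ⟩ := exists_cyclotomicZpExtension_holds ℚ 2
  have hK' := surjective_resolvent_restrict W hΔ κ hκ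
  have hcyc := isCyclotomic_restrict κ hκ _ hK'
  have h3 := classicalLambda_divisionField_two_eq_resolvent_add_two_mul_cubic W ht hΔ hμ3 j κT hκT (κ.restrict _ hK') hcyc κk hκk
  obtain ⟨hK2, hη⟩ := AlignedTransportAtTwoResolventLambdaParity.exists_sq_eq_neg_of_sq_eq W h2 hq hΔd (delta_mem_and_sq W).2
  obtain ⟨-, hFK⟩ := ferreroKida_classicalLambda_two_imaginaryQuadratic_holds ↥ℚ⟮4 * delta W two_ne_zero⟯ d hsf h2 hK2 hη
    (κ.restrict _ hK') hcyc
  omega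

end Summit.BirchSwinnertonDyer.BirchSwinnertonDyer.Theorems.AlignedTransportAtTwoSexticLambdaKuroda

end
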